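/-
Copyright (c) 2026 the pub-hodgecm-mathlib formalisation cell (harness21).  Prover seat hodgecm-mathlib-K2E1-p12 (g6), Track B ∕ K2-LIT, h413 = `stmt-HodgeConjecture-24833`,
R90-TF section S8 «ContSpec-n½», ESTATE T, S8 dealer R90-CS-plan (g3) deal S8-R229 (1) ∕ ruling J-S8-CO step (5): THE CO-WEIGHT LINE AT THE ARCHIMEDEAN GROUP OF RECORD — the letter `hCO′`
of ★ FILE B ED. 2 `R90S8ResGMidRowsOfTauExportsClosedU3.hEXP_tauRow_closed'` DISCHARGED by assembling ★ (2) the Riesz bridge (this seat), ★ (3) the product transpose realisation of `K_∞`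
(K2E1-p16 (g4), Gelfand's trick at `(K_∞, M_∞)`), ★ (4) the Hilbert packaging of the block (F0P2-p10 (g4)); and (R)′'s `hEXP` τ-row with NO representation-theoretic letter left.
-/
import Summits.HodgeConjecture.HodgeConjecture.Theorems.R90S8CoweightLineOfHomSpaceLineU3              -- ★ p864758 (this seat) J-S8-CO (2): `coweightLine_of_homSpaceLine_restrict`, `coweightLine_of_linearEquiv`
import Summits.HodgeConjecture.HodgeConjecture.Theorems.R90S8ArchMaximalCompactTransposeRealisationU3   -- ★ p864844 (K2E1-p16) J-S8-CO (3): `exists_forall_homSpace_archTorus_eq_smul` (multiplicity one of `M_∞`-types in `K_∞`-types, μ-free)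
import Summits.HodgeConjecture.HodgeConjecture.Theorems.R90S8KFiniteBlockHilbertPackagingU3             -- ★ p864876 (F0P2-p10) J-S8-CO (4): `exists_hilbertPackaging_kInf_block` (unitary trivialisation + Hilbert packaging of the block)
import Summits.HodgeConjecture.HodgeConjecture.Theorems.R90S8ResGMidRowsOfTauExportsClosedU3            -- ★ p864795 (this seat) FILE B ED. 2: `hEXP_tauRow_closed'` (the row from `hμu`, the frame, `hCO′`); brings `isUnitary_blockChar`, `norm_eta∕psi_apply_eq_one`
import HarnessLib

/-!
# R90-TF · S8 «ContSpec-n½» — `R90S8KTypeCoweightLineProductU3`: THE CO-WEIGHT LINE AT `K_∞` (J-S8-CO step (5), the letter `hCO′` PAID) and (R)′'s `hEXP` τ-ROW FROM `hμu` + THE FRAME ALONE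

Cell `hodgecm-mathlib`, crux H413 (`stmt-HodgeConjecture-24833`, lane `--supports … --as helper`), route of record `HCCMUnconditional`; R90-TF section S8, ESTATE T, sub-socket (R)′
`sock_S8_res_midBlock_le_residual` (B ED. 7 :337) row `hEXP`.  THEOREMS ONLY (no `def`, no `instance`, no `notation`, no named-fact hypothesis, no `sorry`; default heartbeats);
count-neutral; CLOSES NO SOCKET (OF-RECORD composition).

THE LETTER.  ★ FILE B ED. 2's `hCO′`: for every irreducible finite-dimensional `ι(K_∞)`-stable `W₀ ≤ (G(𝔸) → ℂ)` of CONTINUOUS `(χ₁, χ₂)`-PAIR-SECTIONS of the `φ_ξ`-block (`τ₀ := r|_{W₀}`,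
`K_∞ := ↥(archMaximalCompact L)`), the linear functionals `l : W₀ → ℂ` with `l (τ₀(ι m) w) = χ₁(m₀₀) χ₂(m₁₁) · l w` for all `m ∈ G_∞` with `ι m ∈ B(𝔸) ∩ K` form AT MOST A LINE.
THE ASSEMBLY (ruling J-S8-CO, interface card l.10061): (4) ★ `exists_hilbertPackaging_kInf_block` gives a unitary trivialisation `e : ↥W₀ ≃ₗ[ℂ] EuclideanSpace ℂ (Fin d)` and a unitary,
strongly continuous, topologically irreducible `π : ContRepresentation ℂ K_∞ (EuclideanSpace ℂ (Fin d))` with `π k (e w) = e (τ₀ k w)`; §1 packages the block character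
`m ↦ χ₁(firstEntryUnit m) · χ₂(middleEntryUnitary m)` of the torus `M_∞ := ↥(archMaximalCompact L ⊓ borelAdelic)` as a unitary irreducible `τ : ContRepresentation ℂ M_∞ ℂ` (unitarity from
`hμu`, ★ `isUnitary_blockChar`, ★ `norm_psi_apply_eq_one`); (3) ★ `exists_forall_homSpace_archTorus_eq_smul` (Gelfand's trick at `(K_∞, M_∞)`: transpose-conjugacy place by place, ★ (α) §1)
makes `Hom_{M_∞}(τ, π|_{M_∞})` a line; (2) ★ `coweightLine_of_homSpaceLine_restrict` turns it into the co-weight FUNCTIONAL line on the Euclidean model and ★ `coweightLine_of_linearEquiv`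
pulls it back through `e`; finally every `m ∈ M_∞` is `ι(a)` with `a ∈ G_∞`, `ι a ∈ B(𝔸)`, `ι a ∈ K` (★ `mem_archMaximalCompact_iff`), so the arch law of `hCO′` is the `M_∞`-law.
* §1 `lineRep_isIrreducible` (a representation on `ℂ` is irreducible), **`exists_lineRep_of_character (χ) (h1) (hmul) (hn : ‖χ m‖ = 1)`** (a unitary character as a unitary irreducible
  `ContRepresentation ℂ M ℂ`, `τ m c = χ m · c`).
* §2 **HEAD `hCO_of_transposeRealisations (hμu : μω.IsUnitary)`** ⊢ ★ FILE B ED. 2's letter `hCO′` BYTE FOR BYTE at the block pair `(ξ.bcη⁻¹ · ξ.bcψ⁻¹ · μω, ξ.ψ)`.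
* §3 **`hEXP_tauRow_of_record (hμu) (frame)`** — (R)′'s `hEXP` ∀-row (★ p864188's binder byte for byte) from `hμu` and the frame ALONE: `hEXP_tauRow_closed' … hμu (hCO_of_transposeRealisations … hμu)`.
BINDER LIST OF (R)′'s `hEXP` ROW AFTER THIS FILE: (F) socket frame `μ` + exports frame `νG ν 𝓕 h𝓕N h𝓕c h𝓕₀ β hβ μZ hμZ`; (F′) the ports' auxiliary Haar frame `μa μf` (with
`[MeasurableSpace∕BorelSpace]` on `G(𝔸)`, `G_∞`, `G(𝔸_f)`); (U) `hμu : μω.IsUnitary`.  NO representation-theoretic, section-side, gauge or level letter remains.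
HONEST LABEL: HC_CM is proved only modulo the 7 printed citations (2 remaining named inputs: hLiu418 = `stmt-HodgeConjecture-24832`, h413 = `stmt-HodgeConjecture-24833`) until rung 0
closes; this row is OF RECORD modulo (F′) + (U) only; (R)′ :337 itself stays `sorry` in B ED. 7 (its other rows are untouched); REL ≠ ★ ≠ WRITTEN ≠ BUILT; count-neutral; unconditional.

## References
* [Knapp1986] A. W. Knapp, *Representation Theory of Semisimple Groups* (1986), VIII §3 (Frobenius reciprocity; multiplicity one on `M`).
* [Helgason2000] S. Helgason, *Groups and Geometric Analysis* (AMS 2000), Ch. IV §3 Thm. 3.1 (Gelfand's trick).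
* [DeitmarEchterhoff2014] A. Deitmar, S. Echterhoff, *Principles of Harmonic Analysis* (2nd ed., 2014), Lemma 6.1.7; §7.3 Lemma 7.3.1.
* [MoeglinWaldspurger1995] C. Mœglin, J.-L. Waldspurger, *Spectral Decomposition and Eisenstein Series* (1995), IV.1.9–IV.1.11.
* [Rogawski1990] J. D. Rogawski, *Automorphic Representations of Unitary Groups in Three Variables* (1990), §12.3, §13.9 (ii).
-/

set_option autoImplicit false
set_option linter.dupNamespace false  -- the mandated namespace `…HodgeConjecture.HodgeConjecture.R90.S8` (LEAD #1 L1) repeats the summit's segment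

noncomputable section

open MeasureTheory Measure Set Filter Topology NumberField IsDedekindDomain ContRepresentation
open Literature.NumberTheory Literature.NumberTheory.Automorphic Literature.NumberTheory.Automorphic.UnitaryGroup Literature.NumberTheory.GaloisRepresentations AdelicGroupData
open Literature.NumberTheory.Automorphic.Arthur2013.Leaves.TECR Literature.NumberTheory.Rogawski1990
open Summit.HodgeConjecture.HodgeConjecture.Cruxes.H413.K2E1BorelEisensteinU
open Summit.HodgeConjecture.HodgeConjecture.Cruxes.H413.K2E1CharacterEisensteinU2Defs
open Summit.HodgeConjecture.HodgeConjecture.Cruxes.H413.K2E1CharacterEisensteinU3PairDefs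
open Summit.HodgeConjecture.HodgeConjecture.Cruxes.H413.K2E1ChiSectionSpaceU3PairDefs
open Summit.HodgeConjecture.HodgeConjecture.Cruxes.H413.K2E1BLBorelSpacesU2Defs Summit.HodgeConjecture.HodgeConjecture.Cruxes.H413.K2E1BLBorelOperatorsU2Defs
open Literature.RepresentationTheory.CompactGroups Literature.MeasureTheory.Group
open scoped ENNReal NNReal InnerProductSpace ComplexConjugate

namespace Summit.HodgeConjecture.HodgeConjecture.R90.S8

/-! ## §1 Characters as unitary irreducible representations on the line `ℂ` -/

section Character

variable {M : Type*} [Group M]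

/-- Every representation of `M` on the line `ℂ` is irreducible (`ℂ` is a simple `ℂ`-module, and subrepresentations inject into submodules). [cite: Knapp1986, VIII §3] -/
theorem lineRep_isIrreducible (τ : Representation ℂ M ℂ) : τ.IsIrreducible := by
  haveI : IsSimpleOrder (Submodule ℂ ℂ) := IsSimpleModule.toIsSimpleOrder
  have hinj := (Subrepresentation.toSubmodule_injective (ρ := τ))
  refine { exists_pair_ne := ⟨⊥, ⊤, fun h => ?_⟩, eq_bot_or_eq_top := fun W => ?_ }
  · exact (bot_ne_top : (⊥ : Submodule ℂ ℂ) ≠ ⊤) (congrArg Subrepresentation.toSubmodule h)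
  · rcases IsSimpleOrder.eq_bot_or_eq_top W.toSubmodule with h | h
    · exact Or.inl (hinj (h.trans rfl))
    · exact Or.inr (hinj (h.trans rfl))

/-- **A unitary character as a representation on `ℂ`**: a multiplicative `χ : M → ℂ` of modulus `1` is packaged as `τ : ContRepresentation ℂ M ℂ`, `τ m c = χ m · c`, unitary
(`⟪τ m v, τ m w⟫ = ⟪v, w⟫`) and irreducible — the `(W := ℂ, τ)` input of ★ `exists_forall_homSpace_torus_eq_smul_of_transpose_realisation` ∕ its product version. [cite: Knapp1986, VIII §3]
[cite: DeitmarEchterhoff2014, Lemma 6.1.7] -/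
theorem exists_lineRep_of_character (χ : M → ℂ) (h1 : χ 1 = 1) (hmul : ∀ a b : M, χ (a * b) = χ a * χ b) (hn : ∀ m : M, ‖χ m‖ = 1) :
    ∃ τ : ContRepresentation ℂ M ℂ, (∀ (m : M) (c : ℂ), τ m c = χ m * c) ∧ (∀ (m : M) (v w : ℂ), ⟪τ m v, τ m w⟫_ℂ = ⟪v, w⟫_ℂ) ∧
      τ.toRepresentation.IsIrreducible := by
  let f : M →* (ℂ →L[ℂ] ℂ) :=
    { toFun := fun m => χ m • (1 : ℂ →L[ℂ] ℂ)
      map_one' := by rw [h1, one_smul]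
      map_mul' := fun a b => ContinuousLinearMap.ext fun z => by simp [hmul]; ring }
  have happ : ∀ (m : M) (c : ℂ), (ContRepresentation.ofMonoidHom f) m c = χ m * c := fun m c => rfl
  refine ⟨ContRepresentation.ofMonoidHom f, happ, fun m v w => ?_, lineRep_isIrreducible _⟩
  rw [happ, happ, RCLike.inner_apply', RCLike.inner_apply', map_mul, mul_mul_mul_comm, Complex.conj_mul', hn]
  simp

end Character

/-! ## §2 HEAD: the co-weight line at the archimedean group of record (`hCO′` PAID) -/

section Assembly

variable (L : Type) [Field L] [NumberField L] [IsCMField L] (ξ : OneDimAutRepH L) (μω : HeckeCharacter L)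

/-- **§2 HEAD — `hCO_of_transposeRealisations`: THE CO-WEIGHT LINE AT THE ARCHIMEDEAN GROUP OF RECORD** (★ FILE B ED. 2's letter `hCO′`, byte for byte, at the `φ_ξ`-block pair
`(χ₁, χ₂) := (ξ.bcη⁻¹ · ξ.bcψ⁻¹ · μω, ξ.ψ)`): for every irreducible finite-dimensional `ι(K_∞)`-stable `W₀ ≤ (G(𝔸) → ℂ)` of continuous pair-sections, the linear functionals `l` on `W₀` with
`l (τ₀(ι m) w) = χ₁(firstEntryUnit m) · χ₂(middleEntryUnitary m) · l w` (`m ∈ G_∞`, `ι m ∈ B(𝔸) ∩ K`) form at most a line.  Assembly: (4) ★ `exists_hilbertPackaging_kInf_block` ∘ §1 ∘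
(3) ★ `exists_forall_homSpace_archTorus_eq_smul` ∘ (2) ★ `coweightLine_of_homSpaceLine_restrict` ∘ ★ `coweightLine_of_linearEquiv`, then ★ `mem_archMaximalCompact_iff` to read the
`M_∞`-law off the arch law.  The only hypothesis is `hμu` (unitarity of Rogawski's auxiliary character ⇒ `|χ₁| = 1`, ★ `isUnitary_blockChar`; `|χ₂| = 1` is ★ `norm_psi_apply_eq_one`).
[cite: Knapp1986, VIII §3] [cite: Helgason2000, Ch. IV §3 Thm. 3.1] [cite: DeitmarEchterhoff2014, Lemma 7.3.1] [cite: Rogawski1990, §12.3] -/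
theorem hCO_of_transposeRealisations (hμu : μω.IsUnitary) :
    ∀ (W₀ : Submodule ℂ ((quasiSplit (↥(maximalRealSubfield L)) L (IsCMField.complexConj L) 3).Adelic → ℂ)) (hW₀K : ∀ k : ↥(archMaximalCompact L), ∀ ψ ∈ W₀, ((rightTranslation (quasiSplit (↥(maximalRealSubfield L)) L (IsCMField.complexConj L) 3)).comp (archMaximalCompact L).subtype) k ψ ∈ W₀) (_ : FiniteDimensional ℂ ↥W₀)
      (_ : ∀ ψ ∈ W₀, IsChiSectionPair (ξ.bcη⁻¹ * ξ.bcψ⁻¹ * μω) ξ.ψ ψ) (_ : ∀ ψ ∈ W₀, Continuous ψ) (_ : (Subrepresentation.toRepresentation (⟨W₀, hW₀K⟩ : Subrepresentation ((rightTranslation (quasiSplit (↥(maximalRealSubfield L)) L (IsCMField.complexConj L) 3)).comp (archMaximalCompact L).subtype))).IsIrreducible),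
      ∃ l₀ : ↥W₀ →ₗ[ℂ] ℂ, ∀ l : ↥W₀ →ₗ[ℂ] ℂ,
        (∀ (m : ↥(arch (↥(maximalRealSubfield L)) L (IsCMField.complexConj L) 3 ((StdForm.antidiagonal 3).over L))) (hmB : (archToAdelic (↥(maximalRealSubfield L)) L (IsCMField.complexConj L) 3 ((StdForm.antidiagonal 3).over L)) m ∈ (borelAdelic (↥(maximalRealSubfield L)) L (IsCMField.complexConj L) 3)) (hmK : (adelicVal (↥(maximalRealSubfield L)) L (IsCMField.complexConj L) 3 ((StdForm.antidiagonal 3).over L)) ((archToAdelic (↥(maximalRealSubfield L)) L (IsCMField.complexConj L) 3 ((StdForm.antidiagonal 3).over L)) m) ∈ standardMaximalCompactGL 3 L) (w : ↥W₀),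
          l ((Subrepresentation.toRepresentation (⟨W₀, hW₀K⟩ : Subrepresentation ((rightTranslation (quasiSplit (↥(maximalRealSubfield L)) L (IsCMField.complexConj L) 3)).comp (archMaximalCompact L).subtype))) ⟨(archToAdelic (↥(maximalRealSubfield L)) L (IsCMField.complexConj L) 3 ((StdForm.antidiagonal 3).over L)) m, archToAdelic_mem_archMaximalCompact L m hmK⟩ w) = ((((ξ.bcη⁻¹ * ξ.bcψ⁻¹ * μω)) (firstEntryUnit hmB) : ℂˣ) : ℂ) * (((ξ.ψ) (middleEntryUnitary hmB) : ℂˣ) : ℂ) * l w) →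
        ∃ a : ℂ, l = a • l₀ := by
  intro W₀ hW₀K hfd hW₀P hW₀c hirr
  haveI := hfd
  -- (4) ★ F0P2-p10: a unitary trivialisation `e` of the block and the Hilbert packaging `π` of `τ₀` on the Euclidean model
  obtain ⟨e, π, hπρ, hπU, hπc, hπirr⟩ := exists_hilbertPackaging_kInf_block L (ξ.bcη⁻¹ * ξ.bcψ⁻¹ * μω) ξ.ψ W₀ hW₀K hW₀P hW₀c hirr
  -- §1: the block character of `M_∞` as a unitary irreducible representation on `ℂ`
  have hχ₁u : ∀ x, ‖((((ξ.bcη⁻¹ * ξ.bcψ⁻¹ * μω)) x : ℂˣ) : ℂ)‖ = 1 := isUnitary_blockChar L ξ μω hμu (norm_eta_apply_eq_one L ξ) (norm_psi_apply_eq_one L ξ)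
  have hF1 : ∀ (b : (quasiSplit (↥(maximalRealSubfield L)) L (IsCMField.complexConj L) 3).Adelic) (hb : b ∈ (borelAdelic (↥(maximalRealSubfield L)) L (IsCMField.complexConj L) 3)), b = 1 →
      ((((ξ.bcη⁻¹ * ξ.bcψ⁻¹ * μω)) (firstEntryUnit hb) : ℂˣ) : ℂ) * (((ξ.ψ) (middleEntryUnitary hb) : ℂˣ) : ℂ) = 1 := by
    rintro b hb rfl
    rw [show firstEntryUnit hb = 1 from firstEntryUnit_one, show middleEntryUnitary hb = 1 from middleEntryUnitary_one, map_one, map_one, Units.val_one, one_mul]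
  have hFmul : ∀ (b b' : (quasiSplit (↥(maximalRealSubfield L)) L (IsCMField.complexConj L) 3).Adelic) (hb : b ∈ (borelAdelic (↥(maximalRealSubfield L)) L (IsCMField.complexConj L) 3)) (hb' : b' ∈ (borelAdelic (↥(maximalRealSubfield L)) L (IsCMField.complexConj L) 3)) (hbb' : b * b' ∈ (borelAdelic (↥(maximalRealSubfield L)) L (IsCMField.complexConj L) 3)),
      ((((ξ.bcη⁻¹ * ξ.bcψ⁻¹ * μω)) (firstEntryUnit hbb') : ℂˣ) : ℂ) * (((ξ.ψ) (middleEntryUnitary hbb') : ℂˣ) : ℂ) =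
        (((((ξ.bcη⁻¹ * ξ.bcψ⁻¹ * μω)) (firstEntryUnit hb) : ℂˣ) : ℂ) * (((ξ.ψ) (middleEntryUnitary hb) : ℂˣ) : ℂ)) *
          (((((ξ.bcη⁻¹ * ξ.bcψ⁻¹ * μω)) (firstEntryUnit hb') : ℂˣ) : ℂ) * (((ξ.ψ) (middleEntryUnitary hb') : ℂˣ) : ℂ)) := by
    intro b b' hb hb' hbb'
    rw [show firstEntryUnit hbb' = firstEntryUnit hb * firstEntryUnit hb' from firstEntryUnit_mul hb hb',
      show middleEntryUnitary hbb' = middleEntryUnitary hb * middleEntryUnitary hb' from middleEntryUnitary_mul hb hb', map_mul, map_mul,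
      Units.val_mul, Units.val_mul]
    ring
  obtain ⟨τχ, hτapp, hτu, hτirr⟩ := exists_lineRep_of_character
    (fun m : ↥(archMaximalCompact L ⊓ borelAdelic (↥(maximalRealSubfield L)) L (IsCMField.complexConj L) 3) => ((((ξ.bcη⁻¹ * ξ.bcψ⁻¹ * μω)) (firstEntryUnit (Subgroup.mem_inf.1 m.2).2) : ℂˣ) : ℂ) * (((ξ.ψ) (middleEntryUnitary (Subgroup.mem_inf.1 m.2).2) : ℂˣ) : ℂ))
    (hF1 _ _ rfl) (fun a b => hFmul (a : (quasiSplit (↥(maximalRealSubfield L)) L (IsCMField.complexConj L) 3).Adelic) (b : (quasiSplit (↥(maximalRealSubfield L)) L (IsCMField.complexConj L) 3).Adelic) _ _ _)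
    (fun m => by rw [norm_mul, hχ₁u, norm_psi_apply_eq_one L ξ, one_mul])
  -- (3) ★ K2E1-p16: the multiplicity-space line at `(K_∞, M_∞)` (Gelfand's trick, transpose-conjugacy place by place)
  haveI := hτirr
  obtain ⟨S₀, hS₀⟩ := exists_forall_homSpace_archTorus_eq_smul L π hπc hπU hπirr τχ hτu
  -- (2) ★ this seat: the functional line on the Euclidean model, pulled back to `W₀` through `e`
  have hE := coweightLine_of_homSpaceLine_restrict (Subgroup.inclusion (inf_le_left : archMaximalCompact L ⊓ borelAdelic (↥(maximalRealSubfield L)) L (IsCMField.complexConj L) 3 ≤ archMaximalCompact L)) π hπU τχ hτu ⟨S₀, hS₀⟩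
  obtain ⟨l₀, hl₀⟩ := coweightLine_of_linearEquiv (M := ↥(archMaximalCompact L ⊓ borelAdelic (↥(maximalRealSubfield L)) L (IsCMField.complexConj L) 3)) e (fun m => (Subrepresentation.toRepresentation (⟨W₀, hW₀K⟩ : Subrepresentation ((rightTranslation (quasiSplit (↥(maximalRealSubfield L)) L (IsCMField.complexConj L) 3)).comp (archMaximalCompact L).subtype))) ((Subgroup.inclusion (inf_le_left : archMaximalCompact L ⊓ borelAdelic (↥(maximalRealSubfield L)) L (IsCMField.complexConj L) 3 ≤ archMaximalCompact L)) m)) (fun m x => π ((Subgroup.inclusion (inf_le_left : archMaximalCompact L ⊓ borelAdelic (↥(maximalRealSubfield L)) L (IsCMField.complexConj L) 3 ≤ archMaximalCompact L)) m) x)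
    (fun m v => hπρ ((Subgroup.inclusion (inf_le_left : archMaximalCompact L ⊓ borelAdelic (↥(maximalRealSubfield L)) L (IsCMField.complexConj L) 3 ≤ archMaximalCompact L)) m) v) (fun m => τχ m 1) hE
  refine ⟨l₀, fun l hl => hl₀ l fun m v => ?_⟩
  -- the arch law of `hCO′` implies the `M_∞`-law: write `m = ι(a)` with `a ∈ G_∞`
  obtain ⟨x, hx⟩ := m
  have hxA : x ∈ archMaximalCompact L := (Subgroup.mem_inf.1 hx).1
  have hxB : x ∈ (borelAdelic (↥(maximalRealSubfield L)) L (IsCMField.complexConj L) 3) := (Subgroup.mem_inf.1 hx).2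
  refine (((mem_archMaximalCompact_iff L x).1 hxA).2).elim fun a ha => ?_
  subst ha
  have hτ1 : τχ ⟨(archToAdelic (↥(maximalRealSubfield L)) L (IsCMField.complexConj L) 3 ((StdForm.antidiagonal 3).over L)) a, hx⟩ 1 = ((((ξ.bcη⁻¹ * ξ.bcψ⁻¹ * μω)) (firstEntryUnit hxB) : ℂˣ) : ℂ) * (((ξ.ψ) (middleEntryUnitary hxB) : ℂˣ) : ℂ) :=
    (hτapp _ 1).trans (mul_one _)
  exact (hl a hxB ((mem_archMaximalCompact_iff L _).1 hxA).1 v).trans (congrArg (fun z : ℂ => z * l v) hτ1.symm)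

end Assembly

/-! ## §3 (R)′'s `hEXP` τ-row from `hμu` and the frame alone -/

section Row

variable (L : Type) [Field L] [NumberField L] [IsCMField L]
  [MeasurableSpace (quasiSplit (↥(maximalRealSubfield L)) L (IsCMField.complexConj L) 3).Adelic] [BorelSpace (quasiSplit (↥(maximalRealSubfield L)) L (IsCMField.complexConj L) 3).Adelic]
  [MeasurableSpace ↥(arch (↥(maximalRealSubfield L)) L (IsCMField.complexConj L) 3 ((StdForm.antidiagonal 3).over L))] [BorelSpace ↥(arch (↥(maximalRealSubfield L)) L (IsCMField.complexConj L) 3 ((StdForm.antidiagonal 3).over L))] [MeasurableSpace ↥(finAdelic (↥(maximalRealSubfield L)) L (IsCMField.complexConj L) 3 ((StdForm.antidiagonal 3).over L))] [BorelSpace ↥(finAdelic (↥(maximalRealSubfield L)) L (IsCMField.complexConj L) 3 ((StdForm.antidiagonal 3).over L))]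
  (μ : Measure (quasiSplit (↥(maximalRealSubfield L)) L (IsCMField.complexConj L) 3).automorphicQuotient) [(quasiSplit (↥(maximalRealSubfield L)) L (IsCMField.complexConj L) 3).IsAutomorphicMeasure μ]
  (νG : Measure (quasiSplit (↥(maximalRealSubfield L)) L (IsCMField.complexConj L) 3).Adelic) [νG.IsHaarMeasure] [νG.IsInvInvariant] [SFinite νG]
  (ν : Measure ↥(adelicUnipotent (↥(maximalRealSubfield L)) L (IsCMField.complexConj L) 3)) [ν.IsHaarMeasure] [ν.IsMulRightInvariant] [ν.IsInvInvariant]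
  {𝓕 : Set ↥(adelicUnipotent (↥(maximalRealSubfield L)) L (IsCMField.complexConj L) 3)}
  (h𝓕N : IsFundamentalDomain ↥(rationalUnipotent (↥(maximalRealSubfield L)) L (IsCMField.complexConj L) 3) 𝓕 ν) (h𝓕c : IsCompact (closure 𝓕)) (h𝓕₀ : ν 𝓕 ≠ 0)
  {β : (quasiSplit (↥(maximalRealSubfield L)) L (IsCMField.complexConj L) 3).Adelic → ℝ≥0∞}
  (hβ : IsCoveringWeight ↥((arithmeticBorel (↥(maximalRealSubfield L)) L (IsCMField.complexConj L) 3).map (quasiSplit (↥(maximalRealSubfield L)) L (IsCMField.complexConj L) 3).arithmeticSubgroup.subtype) β)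
  {μZ : Measure (borelQuotient (↥(maximalRealSubfield L)) L (IsCMField.complexConj L) 3)} [SFinite μZ]
  (hμZ : ∀ f : borelQuotient (↥(maximalRealSubfield L)) L (IsCMField.complexConj L) 3 → ℝ≥0∞, Measurable f → ∫⁻ z, f z ∂μZ = ∫⁻ g, β g * f (toBorelQuotient (↥(maximalRealSubfield L)) L (IsCMField.complexConj L) 3 g) ∂νG)
  (μa : Measure ↥(arch (↥(maximalRealSubfield L)) L (IsCMField.complexConj L) 3 ((StdForm.antidiagonal 3).over L))) [μa.IsHaarMeasure] [μa.IsMulRightInvariant]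
  (μf : Measure ↥(finAdelic (↥(maximalRealSubfield L)) L (IsCMField.complexConj L) 3 ((StdForm.antidiagonal 3).over L))) [μf.IsHaarMeasure]
  (ξ : OneDimAutRepH L) (μω : HeckeCharacter L)

include μ h𝓕N h𝓕c h𝓕₀ hβ hμZ μa μf in
/-- **§3 — `hEXP_tauRow_of_record`**: the `hEXP` binder of ★ p864188 `res_midBlock_le_residual_of_tauAdmissible` at the `φ_ξ`-block — (E4) «`Ec z` continuous on `G(𝔸)`» and (E2-bd)
«joint local bound, uniformly on compacts» for the own continuation of EVERY τ-admissible generator datum on `{1 < Re} ∖ Sp` — BYTE FOR BYTE, from `hμu` and the frame ALONE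
(★ `hEXP_tauRow_closed'` with its letter `hCO′` := §2 `hCO_of_transposeRealisations`).  Binders of record: (F) socket + exports frame, (F′) ports' Haar frame `μa μf`, (U) `hμu`.
[cite: MoeglinWaldspurger1995, IV.1.9–IV.1.11] [cite: Rogawski1990, §13.9 (ii)] [cite: Knapp1986, VIII §3] -/
theorem hEXP_tauRow_of_record (hμu : μω.IsUnitary) :
    ∀ (U₀ : Subgroup ↥(finAdelic (↥(maximalRealSubfield L)) L (IsCMField.complexConj L) 3 ((StdForm.antidiagonal 3).over L))) (_ : IsTauLevel L U₀)
      (φ : (quasiSplit (↥(maximalRealSubfield L)) L (IsCMField.complexConj L) 3).Adelic → ℂ) (_ : φ ∈ chiSectionSpacePair (ξ.bcη⁻¹ * ξ.bcψ⁻¹ * μω) ξ.ψ (tauLevel L U₀) ((1 : ↥(tauLevel L U₀) →* ℂ) : ↥(tauLevel L U₀) → ℂ)) (_ : Continuous φ)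
      (_ : IsArchFinite L φ)
      (Ec : ℂ → (quasiSplit (↥(maximalRealSubfield L)) L (IsCMField.complexConj L) 3).Adelic → ℂ) (Sp : Finset ℂ) (_ : ∀ s ∈ Sp, s.im = 0 ∧ 1 < s.re ∧ s.re ≤ 2)
      (_ : ∀ g, DifferentiableOn ℂ (fun z => Ec z g) ({z : ℂ | 1 < z.re} \ (↑Sp : Set ℂ)))
      (_ : ∀ z : ℂ, 2 < z.re → Ec z = eisensteinSeriesU (flatSectionU φ z))
      (Fp : (quasiSplit (↥(maximalRealSubfield L)) L (IsCMField.complexConj L) 3).Adelic → ℂ → ℂ) (_ : ∀ g, AnalyticAt ℂ (Fp g) ((3 : ℂ) / 2))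
      (_ : ∀ g, Fp g =ᶠ[𝓝[≠] ((3 : ℂ) / 2)] fun z => (z - (3 : ℂ) / 2) * Ec z g)
      (f : (quasiSplit (↥(maximalRealSubfield L)) L (IsCMField.complexConj L) 3).L2 μ) (_ : (f : (quasiSplit (↥(maximalRealSubfield L)) L (IsCMField.complexConj L) 3).automorphicQuotient → ℂ) =ᵐ[μ] fun x => Fp (Quotient.out (x : (quasiSplit (↥(maximalRealSubfield L)) L (IsCMField.complexConj L) 3).Adelic ⧸ (quasiSplit (↥(maximalRealSubfield L)) L (IsCMField.complexConj L) 3).quotientSubgroup))⁻¹ ((3 : ℂ) / 2)), (∀ z ∈ ({z : ℂ | 1 < z.re} \ (↑Sp : Set ℂ)), Continuous (Ec z)) ∧ (∀ z₁ ∈ ({z : ℂ | 1 < z.re} \ (↑Sp : Set ℂ)), ∀ K : Set (quasiSplit (↥(maximalRealSubfield L)) L (IsCMField.complexConj L) 3).Adelic, IsCompact K → ∃ V ∈ 𝓝 z₁, ∃ M : ℝ, ∀ z ∈ V, ∀ g ∈ K, ‖Ec z g‖ ≤ M)  :=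
  hEXP_tauRow_closed' L μ νG ν h𝓕N h𝓕c h𝓕₀ hβ hμZ μa μf ξ μω hμu (hCO_of_transposeRealisations L ξ μω hμu)

end Row

end Summit.HodgeConjecture.HodgeConjecture.R90.S8

end
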